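import Summits.Ventures.LatticeQCDFlow.Scaling.DominatedStarRegimeFreeRelaxation
import Literature.Probability.MarkovChains.RelaxationTimeVarianceDecay
import Literature.Probability.MarkovChains.SeparationDistance

/-!
HONEST FRAMING: exact (Metropolis-corrected) sampling algorithms for lattice gauge theory; figures
of merit are autocorrelation/cost numbers at stated couplings and volumes; no continuum-physics
claim.

# DominatedStarRegimeFreeWarmStart — WARM STARTS WITHOUT THE REGIME, BY THE `ℓ²` ROUTE: FOR ANY REVERSIBLE IRREDUCIBLE CHAIN AND ANY
# START `λ = g·π`, `‖λPⁿ − π‖_TV ≤ ½·(1 − γ⋆)ⁿ·√Var_π(g)`; FOR THE MAP-ASSISTED HOT-REFRESHED HUB (ENTRY MAPS, NO `4t ≤ p(1−t)w_0`)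
# `‖λPⁿ − π̃‖_TV ≤ ½·e^{−Gn}·√Var_π̃(g)`, `G = p·min{ct/(3m), (1−t)w_0/(7K)}`, SO `n ≥ G⁻¹·(½·log Var_π̃(g) + log(1/(2ε)))` STEPS SUFFICE;
# A PRODUCT START EXACT OFF `D₀` AND PINNED AT `x_k` ON `D₀` HAS `1 + Var_π̃(g) = Π_{k∈D₀} 1/μ_k(x_k)` — THE PERTURBED REPLICAS' OWN
# LOGARITHM, NOT THE VOLUME (lean-2 GEN-28, ours)

Venture-side (OURS).  Cell `lqcd-flow` (pub-lqcd), unit `pub-lqcd-lean-2-g28`, 2026-08-28.  Chapter N, file 9: the W-line of chapter M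
(`Scaling/WarmStartCeiling`, W2: after perturbing `j` replicas of an equilibrated ladder, `(2m/(tcp))·log((2j+p)/(pε))` inside the
regime) without the regime.  The certificate is the variance decay `Var_π(Pᵗg) ≤ (1−γ⋆)^{2t}Var_π(g)` (Levin–Peres–Wilmer (12.8), in
the tree) applied to the DENSITY `g = dλ/dπ` of the start, which reversibility turns into the density of `λPᵗ`; the price of a warm
start is `½·log Var_π̃(g)`, which for a product start pinned on a set `D₀` of replicas is at most `½·Σ_{k∈D₀} log(1/μ_k(x_k))`.

## What is proved

* §0 (any finite chain) `lawAt_density_eq` (`(λPᵗ)(y) = π(y)·(Pᵗg)(y)` for `λ = g·π`, `P` reversible),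
  **`tvDist_lawAt_le_of_density`** — `P` reversible, irreducible, `π > 0` a probability vector, `λ = g·π` a probability vector:
  **`‖λPᵗ − π‖_TV ≤ ½·(1 − γ⋆)ᵗ·√Var_π(g)`**.
* §1 **`dominatedStar_warmStart_tvDist_le_regimeFree`** — for the chapter-M scheme with entry maps (exact hot sampler, one-sided
  domination, reversible cold kernels, multiplicities `≥ c ≥ 1`, `0 < t < 1`, `w_0 > 0`, `K ≥ 1`, `|S| ≥ 2`):
  `‖λPⁿ − π̃‖_TV ≤ ½·exp(−G·n)·√Var_π̃(g)`; **`dominatedStar_warmStart_tvDist_le_of_ge_log`** — `≤ ε` once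
  `n ≥ G⁻¹·(½·log(Var_π̃(g)) + log(1/(2ε)))` (`Var_π̃(g) > 0`; the right side may be negative when `Var < 1`, then any `n` works).
* §2 **`pinnedStart_variance_eq`** — the product start `λ = ⊗λ_k`, `λ_k = μ_k` off `D₀`, `λ_k = δ_{x_k}` on `D₀`, has density
  `g(z) = Π_{k∈D₀} 𝟙{z_k = x_k}/μ_k(x_k)` with `Σ_z π̃(z)g(z) = 1` and **`1 + Var_π̃(g) = Π_{k∈D₀} 1/μ_k(x_k)`**.

Reading (no numerics implied): re-equilibrating `j` replaced replicas of an otherwise equilibrated hub costs at most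
`G⁻¹·(½Σ_{k∈D₀}log(1/μ_k(x_k)) + log(1/(2ε)))` steps whatever `t/p` — the replaced replicas' configuration logarithm, not the whole
ladder's; chapter M's `log j` needs the regime.  NOT CLAIMED: `log j` outside the regime; non-product starts beyond their `χ²`; anything
measured.  Literature grade (cell rule): OWN COMPOSITION on N4 and the tree's (12.8) / Lemma 12.18 route; nothing cited as a fact; no new
bib keys.
-/

noncomputable section

open Finset Function Matrix
open Literature.Probability.MarkovChains

namespace Summit.Ventures.LatticeQCDFlow.Scaling

/-! ## §0 The `ℓ²` warm-start bound for any reversible chain -/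

/-- For a reversible `P` and `λ = g·π`: `(λPᵗ)(y) = π(y)·Σ_x Pᵗ(y,x)g(x)`. [ours] -/
theorem lawAt_density_eq {X : Type*} [Fintype X] [DecidableEq X] {π : X → ℝ} {P : Matrix X X ℝ} (hDB : DetailedBalance π P)
    (g : X → ℝ) (t : ℕ) (y : X) :
    lawAt P (fun x => π x * g x) t y = π y * ∑ x, kernelAt P t y x * g x := by
  rw [lawAt_eq_stepLaw_kernelAt]
  unfold stepLaw
  rw [mul_sum]
  refine sum_congr rfl fun x _ => ?_
  have h := hDB.kernelAt t x y
  calc π x * g x * kernelAt P t x y = (π x * kernelAt P t x y) * g x := by ring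
    _ = (π y * kernelAt P t y x) * g x := by rw [h]
    _ = π y * (kernelAt P t y x * g x) := by ring

/-- **THE `ℓ²` WARM-START BOUND: `‖λPᵗ − π‖_TV ≤ ½·(1 − γ⋆)ᵗ·√Var_π(g)`** for `λ = g·π` a probability vector, `P` reversible and
irreducible w.r.t. the positive probability vector `π` (`Pᵗg` has `π`-mean `1` and `π`-variance `≤ (1−γ⋆)^{2t}Var_π(g)`; Cauchy–Schwarz).
[ours] -/
theorem tvDist_lawAt_le_of_density {X : Type*} [Fintype X] [DecidableEq X] {π : X → ℝ} (hπ : ∀ x, 0 < π x)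
    (hπ1 : ∑ x, π x = 1) {P : Matrix X X ℝ} (hP : IsRowStochastic P) (hDB : DetailedBalance π P)
    (hirr : Literature.Probability.MarkovChains.IsIrreducible P) {g : X → ℝ} (hg1 : ∑ x, π x * g x = 1) (t : ℕ) :
    tvDist (lawAt P (fun x => π x * g x) t) π ≤ 1 / 2 * (1 - absSpectralGap P) ^ t * Real.sqrt (lawVariance π g) := by
  set h : X → ℝ := fun y => ∑ x, kernelAt P t y x * g x with hh
  have hst : IsStationary π P := hDB.isStationary hP.2
  -- the density of `λPᵗ` is `Pᵗg`
  have hdens : ∀ y, lawAt P (fun x => π x * g x) t y / π y - 1 = h y - 1 := by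
    intro y
    rw [lawAt_density_eq hDB g t y, mul_div_cancel_left₀ _ (hπ y).ne']
  -- `4TV² ≤ Σ π (Pᵗg − 1)² = Var(Pᵗg)`
  have h4 := four_mul_tvDist_sq_le_piInner hπ hπ1 (lawAt P (fun x => π x * g x) t)
  have hmean : lawMean π h = 1 := by
    rw [hh, lawMean_kernelAt_mul hst g t]
    unfold lawMean
    exact hg1
  have hvar : piInner π (fun y => lawAt P (fun x => π x * g x) t y / π y - 1)
      (fun y => lawAt P (fun x => π x * g x) t y / π y - 1) = lawVariance π h := by
    have e : (fun y => lawAt P (fun x => π x * g x) t y / π y - 1) = fun y => h y - 1 := funext hdens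
    rw [e, piInner_sub_const_eq hπ1 h 1, hmean]
    ring
  rw [hvar] at h4
  -- `Var(Pᵗg) ≤ (1−γ⋆)^{2t} Var(g)`
  have hdecay := LevinPeres2017_eq_12_8 hπ hπ1 hP hDB hirr g t
  have hVg : 0 ≤ lawVariance π g := lawVariance_nonneg (fun x => (hπ x).le) g
  have hlam0 : 0 ≤ 1 - absSpectralGap P := by
    unfold absSpectralGap; linarith [lambdaStar_nonneg (P : X → X → ℝ)]
  have hdecay' : lawVariance π h ≤ (1 - absSpectralGap P) ^ (2 * t) * lawVariance π g := hdecay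
  have hsq : (2 * tvDist (lawAt P (fun x => π x * g x) t) π) ^ 2
      ≤ ((1 - absSpectralGap P) ^ t * Real.sqrt (lawVariance π g)) ^ 2 := by
    have e : ((1 - absSpectralGap P) ^ t * Real.sqrt (lawVariance π g)) ^ 2
        = (1 - absSpectralGap P) ^ (2 * t) * lawVariance π g := by
      rw [mul_pow, ← pow_mul, mul_comm t 2, Real.sq_sqrt hVg]
    rw [e]
    nlinarith [h4, hdecay']
  have hnonneg : 0 ≤ (1 - absSpectralGap P) ^ t * Real.sqrt (lawVariance π g) :=
    mul_nonneg (pow_nonneg hlam0 t) (Real.sqrt_nonneg _)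
  have htv0 : 0 ≤ 2 * tvDist (lawAt P (fun x => π x * g x) t) π := mul_nonneg zero_le_two (tvDist_nonneg _ _)
  have h2 : 2 * tvDist (lawAt P (fun x => π x * g x) t) π ≤ (1 - absSpectralGap P) ^ t * Real.sqrt (lawVariance π g) := by
    have h3 := Real.sqrt_le_sqrt hsq
    rwa [Real.sqrt_sq htv0, Real.sqrt_sq hnonneg] at h3
  linarith

variable {S : Type*} [Fintype S] [DecidableEq S] {K m : ℕ} {μ : Fin (K + 1) → S → ℝ} {M : Fin (K + 1) → S → S → ℝ}
  {w : Fin (K + 1) → ℝ} {t p : ℝ}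

section EntryStar
variable (κ : Fin m → Fin K) (φ : Fin m → Equiv.Perm S)

/-! ## §1 The map-assisted hub from a warm start, without the regime -/

/-- **WARM START, NO REGIME: `‖λPⁿ − π̃‖_TV ≤ ½·exp(−G·n)·√Var_π̃(g)`**, `G = p·min{ct/(3m), (1−t)w_0/(7K)}`, for every start `λ = g·π̃`
(a probability vector) of the chapter-M scheme with entry maps (exact hot sampler, one-sided domination, reversible cold kernels,
multiplicities `≥ c ≥ 1`, `0 < t < 1`, `w_0 > 0`, `K ≥ 1`, `|S| ≥ 2`). [ours] -/
theorem dominatedStar_warmStart_tvDist_le_regimeFree [Nontrivial S] (hK : 1 ≤ K) (hm : 1 ≤ m) (ht0 : 0 < t) (ht1 : t < 1)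
    (hw0 : ∀ k, 0 ≤ w k) (hw00 : 0 < w 0) (hw1 : ∑ k, w k = 1) (hμ : ∀ k x, 0 < μ k x)
    (hμ1 : ∀ k, ∑ u, μ k u = 1) (hM : ∀ k, IsRowStochastic (M k)) (hMrev : ∀ k, DetailedBalance (μ k) (M k))
    (hM0 : ∀ u v, M 0 u v = μ 0 v) (hp0 : 0 < p) (hp1 : p ≤ 1) (hdom : ∀ r u, p * μ (κ r).succ (φ r u) ≤ μ 0 u)
    {c : ℕ} (hc1 : 1 ≤ c) (hc : ∀ p' : Fin K, c ≤ (univ.filter (fun r : Fin m => κ r = p')).card)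
    {g : (Fin (K + 1) → S) → ℝ} (hg1 : ∑ z, tensorFun μ z * g z = 1) (n : ℕ) :
    tvDist (lawAt (fun y z : Fin (K + 1) → S =>
        t * ptGraphSwap μ (fun r : Fin m => (((0 : Fin (K + 1)), (κ r).succ) : Fin (K + 1) × Fin (K + 1))) φ y z
          + (1 - t) * prodKernel w M y z) (fun z => tensorFun μ z * g z) n) (tensorFun μ)
      ≤ 1 / 2 * Real.exp (-(p * min (c * t / (3 * m)) ((1 - t) * w 0 / (7 * K)) * n))
          * Real.sqrt (lawVariance (tensorFun μ) g) := by
  have hgap := dominatedStar_absSpectralGap_ge_regimeFree κ φ hK hm ht0 ht1 hw0 hw00 hw1 hμ hμ1 hM hMrev hM0 hp0 hp1 hdom hc1 hc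
  have h := tvDist_lawAt_le_of_density (tensorFun_pos hμ) (sum_tensorFun_eq_one μ hμ1)
    (weightedScheme_isRowStochastic (ptGraphSwap_isRowStochastic hμ) hM hw0 hw1 ht0.le ht1.le)
    (weightedScheme_detailedBalance (ptGraphSwap_detailedBalance hμ) hMrev t)
    (dominatedStar_isIrreducible_regimeFree κ φ ht0 ht1 hw0 hw00 hw1 hμ hM hM0 hc1 hc) hg1 n
  refine h.trans ?_
  have hsqrt : 0 ≤ Real.sqrt (lawVariance (tensorFun μ) g) := Real.sqrt_nonneg _
  refine mul_le_mul_of_nonneg_right (mul_le_mul_of_nonneg_left ?_ (by norm_num)) hsqrt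
  -- `(1 − γ⋆)ⁿ ≤ (1 − G)ⁿ ≤ e^{−Gn}`
  set G : ℝ := p * min (c * t / (3 * m)) ((1 - t) * w 0 / (7 * K)) with hG
  have hlam0 : 0 ≤ 1 - absSpectralGap (fun y z : Fin (K + 1) → S =>
      t * ptGraphSwap μ (fun r : Fin m => (((0 : Fin (K + 1)), (κ r).succ) : Fin (K + 1) × Fin (K + 1))) φ y z
        + (1 - t) * prodKernel w M y z) := by
    unfold absSpectralGap; linarith [lambdaStar_nonneg (fun y z : Fin (K + 1) → S =>
      t * ptGraphSwap μ (fun r : Fin m => (((0 : Fin (K + 1)), (κ r).succ) : Fin (K + 1) × Fin (K + 1))) φ y z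
        + (1 - t) * prodKernel w M y z)]
  calc (1 - absSpectralGap _) ^ n ≤ (1 - G) ^ n := pow_le_pow_left₀ hlam0 (by linarith) n
    _ ≤ Real.exp (-G) ^ n := by
        refine pow_le_pow_left₀ (by linarith) ?_ n
        have := Real.add_one_le_exp (-G)
        linarith
    _ = Real.exp (-(G * n)) := by rw [← Real.exp_nat_mul]; ring_nf

/-- **WARM START, NO REGIME, LOG FORM:** `‖λPⁿ − π̃‖_TV ≤ ε` once `n ≥ G⁻¹·(½·log Var_π̃(g) + log(1/(2ε)))` (`Var_π̃(g) > 0`). [ours] -/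
theorem dominatedStar_warmStart_tvDist_le_of_ge_log [Nontrivial S] (hK : 1 ≤ K) (hm : 1 ≤ m) (ht0 : 0 < t) (ht1 : t < 1)
    (hw0 : ∀ k, 0 ≤ w k) (hw00 : 0 < w 0) (hw1 : ∑ k, w k = 1) (hμ : ∀ k x, 0 < μ k x)
    (hμ1 : ∀ k, ∑ u, μ k u = 1) (hM : ∀ k, IsRowStochastic (M k)) (hMrev : ∀ k, DetailedBalance (μ k) (M k))
    (hM0 : ∀ u v, M 0 u v = μ 0 v) (hp0 : 0 < p) (hp1 : p ≤ 1) (hdom : ∀ r u, p * μ (κ r).succ (φ r u) ≤ μ 0 u)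
    {c : ℕ} (hc1 : 1 ≤ c) (hc : ∀ p' : Fin K, c ≤ (univ.filter (fun r : Fin m => κ r = p')).card)
    {g : (Fin (K + 1) → S) → ℝ} (hg1 : ∑ z, tensorFun μ z * g z = 1) (hV : 0 < lawVariance (tensorFun μ) g)
    {ε : ℝ} (hε : 0 < ε) {n : ℕ}
    (hn : 1 / (p * min (c * t / (3 * m)) ((1 - t) * w 0 / (7 * K)))
        * (1 / 2 * Real.log (lawVariance (tensorFun μ) g) + Real.log (1 / (2 * ε))) ≤ n) :
    tvDist (lawAt (fun y z : Fin (K + 1) → S =>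
        t * ptGraphSwap μ (fun r : Fin m => (((0 : Fin (K + 1)), (κ r).succ) : Fin (K + 1) × Fin (K + 1))) φ y z
          + (1 - t) * prodKernel w M y z) (fun z => tensorFun μ z * g z) n) (tensorFun μ) ≤ ε := by
  have hKr : (1 : ℝ) ≤ K := by exact_mod_cast hK
  have hmpos : (0 : ℝ) < m := Nat.cast_pos.mpr (by omega)
  have hcpos : (0 : ℝ) < c := Nat.cast_pos.mpr (by omega)
  have h1t : 0 < 1 - t := by linarith
  set G : ℝ := p * min (c * t / (3 * m)) ((1 - t) * w 0 / (7 * K)) with hG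
  have hGpos : 0 < G := mul_pos hp0 (lt_min (by positivity) (by positivity))
  have h := dominatedStar_warmStart_tvDist_le_regimeFree κ φ hK hm ht0 ht1 hw0 hw00 hw1 hμ hμ1 hM hMrev hM0 hp0 hp1 hdom hc1 hc
    hg1 n
  rw [← hG] at h
  refine h.trans ?_
  -- `½ e^{−Gn} √V ≤ ε ⇔ e^{−Gn} ≤ 2ε/√V ⇐ Gn ≥ ½ log V + log(1/(2ε))`
  set V := lawVariance (tensorFun μ) g with hVdef
  have hsqrtpos : 0 < Real.sqrt V := Real.sqrt_pos.mpr hV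
  have hGn : 1 / 2 * Real.log V + Real.log (1 / (2 * ε)) ≤ G * n := by
    have h' := mul_le_mul_of_nonneg_left hn hGpos.le
    rwa [← mul_assoc, mul_one_div_cancel hGpos.ne', one_mul] at h'
  have hexp : Real.exp (-(G * n)) ≤ 2 * ε / Real.sqrt V := by
    have hpos : 0 < 2 * ε / Real.sqrt V := by positivity
    rw [← Real.exp_log hpos]
    apply Real.exp_le_exp.mpr
    rw [Real.log_div (by positivity) hsqrtpos.ne', Real.log_sqrt hV.le]
    have hl : Real.log (1 / (2 * ε)) = -Real.log (2 * ε) := by rw [one_div, Real.log_inv]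
    rw [hl] at hGn
    linarith
  calc 1 / 2 * Real.exp (-(G * n)) * Real.sqrt V ≤ 1 / 2 * (2 * ε / Real.sqrt V) * Real.sqrt V :=
        mul_le_mul_of_nonneg_right (mul_le_mul_of_nonneg_left hexp (by norm_num)) hsqrtpos.le
    _ = ε := by field_simp

end EntryStar

/-! ## §2 The pinned product start: the price is the replaced replicas' own logarithm -/

/-- **THE PINNED PRODUCT START:** `λ = ⊗λ_k` with `λ_k = μ_k` for `k ∉ D₀` and `λ_k = δ_{x_k}` for `k ∈ D₀` is `g·π̃` with
`g(z) = Π_{k∈D₀} 𝟙{z_k = x_k}/μ_k(x_k)`; it is a probability vector and **`1 + Var_π̃(g) = Σ_z π̃(z)g(z)² = Π_{k∈D₀} 1/μ_k(x_k)`**. [ours] -/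
theorem pinnedStart_variance_eq (hμ : ∀ k x, 0 < μ k x) (hμ1 : ∀ k, ∑ u, μ k u = 1) (D₀ : Finset (Fin (K + 1)))
    (x : Fin (K + 1) → S) :
    (∑ z : Fin (K + 1) → S, tensorFun μ z
        * tensorFun (fun k u => if k ∈ D₀ then (if u = x k then 1 / μ k (x k) else 0) else 1) z = 1)
      ∧ 1 + lawVariance (tensorFun μ)
          (tensorFun (fun k u => if k ∈ D₀ then (if u = x k then 1 / μ k (x k) else 0) else 1))
        = ∏ k ∈ D₀, 1 / μ k (x k) := by
  set gk : ∀ k : Fin (K + 1), S → ℝ := fun k u => if k ∈ D₀ then (if u = x k then 1 / μ k (x k) else 0) else 1 with hgk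
  -- first moments coordinate by coordinate
  have hm1 : ∀ k, ∑ u, μ k u * gk k u = 1 := by
    intro k
    by_cases hk : k ∈ D₀
    · have e : ∀ u, μ k u * gk k u = if u = x k then 1 else 0 := by
        intro u
        simp only [hgk, if_pos hk]
        split_ifs with hu
        · rw [hu]; exact mul_one_div_cancel (hμ k (x k)).ne'
        · exact mul_zero _
      rw [Finset.sum_congr rfl fun u _ => e u, Finset.sum_ite_eq' univ (x k), if_pos (mem_univ _)]
    · have e : ∀ u, μ k u * gk k u = μ k u := fun u => by simp only [hgk, if_neg hk, mul_one]
      rw [Finset.sum_congr rfl fun u _ => e u]; exact hμ1 k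
  have hm2 : ∀ k, ∑ u, μ k u * (gk k u * gk k u) = if k ∈ D₀ then 1 / μ k (x k) else 1 := by
    intro k
    by_cases hk : k ∈ D₀
    · rw [if_pos hk]
      have hne := (hμ k (x k)).ne'
      have e : ∀ u, μ k u * (gk k u * gk k u) = if u = x k then 1 / μ k (x k) else 0 := by
        intro u
        simp only [hgk, if_pos hk]
        split_ifs with hu
        · rw [hu]; field_simp
        · ring
      rw [Finset.sum_congr rfl fun u _ => e u, Finset.sum_ite_eq' univ (x k), if_pos (mem_univ _)]
    · rw [if_neg hk]
      have e : ∀ u, μ k u * (gk k u * gk k u) = μ k u := fun u => by simp only [hgk, if_neg hk, mul_one]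
      rw [Finset.sum_congr rfl fun u _ => e u]; exact hμ1 k
  -- the total mass
  have hmass : ∑ z : Fin (K + 1) → S, tensorFun μ z * tensorFun gk z = 1 := by
    simp_rw [tensorFun_mul]
    rw [sum_tensorFun]
    exact Finset.prod_eq_one fun k _ => hm1 k
  refine ⟨hmass, ?_⟩
  -- the second moment
  have hsecond : ∑ z : Fin (K + 1) → S, tensorFun μ z * (tensorFun gk z * tensorFun gk z) = ∏ k ∈ D₀, 1 / μ k (x k) := by
    simp_rw [tensorFun_mul]
    rw [sum_tensorFun]
    rw [show (∏ k : Fin (K + 1), ∑ u, μ k u * (gk k u * gk k u)) = ∏ k : Fin (K + 1), (if k ∈ D₀ then 1 / μ k (x k) else 1)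
      from Finset.prod_congr rfl fun k _ => hm2 k]
    rw [Finset.prod_ite, Finset.prod_const_one, mul_one, Finset.filter_mem_eq_inter, Finset.univ_inter]
  -- `Var = E g² − (E g)²`, `E g = 1`
  have hmean : lawMean (tensorFun μ) (tensorFun gk) = 1 := hmass
  have hvar := piInner_sub_const_eq (sum_tensorFun_eq_one μ hμ1) (tensorFun gk) 0
  simp only [sub_zero] at hvar
  unfold piInner at hvar
  rw [hmean] at hvar
  linarith [hvar, hsecond]

end Summit.Ventures.LatticeQCDFlow.Scaling

end
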